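import Mathlib
import Summits.Ventures.PercRepro2.SwOutCrossBaseEdges

/-!
# The cross base: the blue edge set of the realisation by duality (blind cell PercRepro2, night-4
g23, 2026-08-28; proofs/NIGHT4-G23.md §10, step (2))

The dual base keeps the colour of every class edge, so the red classes and the edge map `φX` of the
dual base are those of the base; with `blue_crossReal` (the blue colouring of a realisation is the
realisation of the dual base at the flipped point) the red edge-set form of the dual base gives the
blue edge-set form: at a point without blue-side leak the blue edges of the blue cluster of `h` are
`φX` of the blue atoms `EBFG` of the point.
-/

namespace Summit.Ventures.PercRepro2

namespace CrossArm

open Hull LocRows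

variable {V E : Type*}

open scoped Classical

section BlueEdges

variable {ends : E → Sym2 V} {σ : Config E} {h u : V} {ι X κ : Type*} {U : ι → Set V}
  {p : X → V} {G : SimpleGraph X} {F : κ → Set V} [Fintype X] [DecidableEq X]
  [DecidableRel G.Adj] [Nonempty X] (hG : G.Connected) (hb : CrossBase ends σ h u U p G F)
include hb

omit [Fintype X] [DecidableEq X] [DecidableRel G.Adj] [Nonempty X] in
/-- The red classes of the dual base are the red classes of the base (class edges keep their
colour under the dual). -/
lemma CrossBase.redClassX_dualCross (α : AtomFG (AtomKEE X G) ι κ) :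
    redClassX ends (dualCross ends u U p G F σ) h u U p G F α =
      redClassX ends σ h u U p G F α := by
  rcases α with (j | ⟨⟨⟩⟩ | i | t) | k
  · ext e
    constructor
    · rintro ⟨hσ, hw⟩
      refine ⟨?_, hw⟩
      rwa [dualCross_apply_of_mem
        (Or.inl (Or.inl (Or.inl (Or.inr ⟨j, hb.touches_U_of_within' hw⟩))))] at hσ
    · rintro ⟨hσ, hw⟩
      refine ⟨?_, hw⟩
      rwa [dualCross_apply_of_mem
        (Or.inl (Or.inl (Or.inl (Or.inr ⟨j, hb.touches_U_of_within' hw⟩))))]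
  · rfl
  · rfl
  · rfl
  · ext e
    constructor
    · rintro ⟨hσ, hw⟩
      refine ⟨?_, hw⟩
      rwa [dualCross_apply_of_mem
        (Or.inl (Or.inl (Or.inl (Or.inl ⟨k, hb.touches_F_of_within hw⟩))))] at hσ
    · rintro ⟨hσ, hw⟩
      refine ⟨?_, hw⟩
      rwa [dualCross_apply_of_mem
        (Or.inl (Or.inl (Or.inl (Or.inl ⟨k, hb.touches_F_of_within hw⟩))))]

omit [Fintype X] [DecidableEq X] [DecidableRel G.Adj] [Nonempty X] in
/-- The edge map of the dual base is the edge map of the base. -/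
lemma CrossBase.φX_dualCross (S : Set (AtomFG (AtomKEE X G) ι κ)) :
    φX ends (dualCross ends u U p G F σ) h u U p G F S = φX ends σ h u U p G F S := by
  simp only [φX, hb.redClassX_dualCross]

omit hb in
/-- The red atoms of the flipped point are the blue atoms of the point. -/
lemma ERFG_toGen_flipXG (q : PtXG ι κ X G) :
    ERFG (fibKEE G hG) (toGen G (flipXG G q)) = EBFG (fibKEE G hG) (toGen G q) := rfl

/-- **The blue edge-set form of the hull formula**: at a point without blue-side leak, the blue
edges of the blue cluster of `h` are `φX` of the blue atoms (edge atoms) of the point. -/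
theorem CrossBase.blueEdges_crossReal (hup : ∀ i, ∃ e, ends e = s(u, p i))
    (hcross : ∀ i j, G.Adj i j → ∃ e, ends e = s(p i, p j)) {q : PtXG ι κ X G}
    (hq : ¬ LeakBX G q) :
    blueEdges ends (crossReal ends u U p G F σ q) h =
      φX ends σ h u U p G F (EBFG (fibKEE G hG) (toGen G q)) := by
  rw [blueEdges, hb.blue_crossReal, hb.dual.redEdges_crossReal hG hup hcross hq, hb.φX_dualCross,
    ERFG_toGen_flipXG]

omit hb in
/-- The leak of the generic point is the red-side or the blue-side leak of the point. -/
lemma leakG_toGen_iff (q : PtXG ι κ X G) :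
    LeakG (fibKEE G hG) (toGen G q).2 ↔ LeakRX G q ∨ LeakBX G q := by
  simp only [LeakG, LeakRX, LeakBX, flipXG, toGen, fibKEE, leakKE, redUG, blueUG, flipAll,
    decide_eq_true_eq, Bool.not_eq_true']

end BlueEdges

end CrossArm

end Summit.Ventures.PercRepro2
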